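import Summits.BirchSwinnertonDyer.BirchSwinnertonDyer.Theorems.Rank2Observatory2DescCoordCert
import Summits.BirchSwinnertonDyer.BirchSwinnertonDyer.Theorems.Rank2Observatory2DescKillList
import Summits.BirchSwinnertonDyer.BirchSwinnertonDyer.Theorems.Rank2Observatory2DescAdmResidue
import Summits.BirchSwinnertonDyer.BirchSwinnertonDyer.Theorems.Rank2Observatory2DescIrredModP
import HarnessLib

/-!
# BirchSwinnertonDyer — rank ≥ 2 observatory: ROW CERTIFICATES — the data of a per-curve 2-descent and its kernel checker (KERNEL-2DESC v2.0, S2a)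

HONEST FRAMING: per-curve certified theorems and census instruments; no claim on BSD in rank ≥ 2.

Generic addendum of the KERNEL-2DESC instrument (design `b2b-bsdr2-cert-3/KERNEL-2DESC.md` §12: the
RESHAPE of the per-curve certificate stream into sharded row files, gate4 CERT-LANE ruling 2026-08-22).
A v1.x per-curve file proves ≈ 25 declarations by tactics; every one of them is "integer data + a landed
generic lemma + a kernel-decidable side condition". This file fixes the DATA of one curve's certificate
relative to a monogenic complex cubic field `K = ℚ(α)` (`structure GenData`, `structure CurveCert`), the
Bool CHECKER `CurveCert.check` (every clause decidable by `decide +kernel` from the integers alone), and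
proves the clause-level soundness lemmas: the model is elliptic (`isElliptic_of_deltaShort_ne`),
`F` is irreducible (`irreducible_of_noRootMod`), each listed generator is a prime element with the listed
norm and real sign (`GenData.prime_of_check`, `GenData.norm_of_check`, `GenData.sign_iff_of_check`), the
residue certificate of a degree-`2`/`3` prime (`cert_of_powCertMod`); the killed classes ride on the landed
list-kill generic (`KillEntry`, `killListCheck`, `admKills`). The assembly theorem
`rank_le_two_of_check` (S2b) then consumes `check = true` exactly as the v1.x template consumed its 25
lemmas (`mordellWeilRank_le_of_coverSet_lt`). Rational primality of the few primes below the generators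
stays a `norm_num` side goal of the row (kernel `decide` on `Nat.Prime` does not scale). Sorry-free;
axioms `propext`, `Classical.choice`, `Quot.sound`. [folklore]
[cite: Cassels1991LecturesEllipticCurves, §15] [cite: CremonaAlgorithms1997, §3.6] [cite: Marcus2018, Ch. 3, Thm. 22]
-/

-- single-conjunct summit: `Summit.BirchSwinnertonDyer.BirchSwinnertonDyer.…` repeats the name by design
set_option linter.dupNamespace false

open scoped NumberField

open Literature.NumberTheory.NumberFields Polynomial Module NumberField

namespace Summit.BirchSwinnertonDyer.BirchSwinnertonDyer.Rank2Observatory.TwoDescCubic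

/-! ## Row data -/

/-- One prime generator `g = c₀ + c₁α + c₂α²` of the support of `F′(θ)`: coordinates, norm `n = ±p^f`,
the rational prime `p`, residue degree `f ∈ {1,2,3}`, exponent `e` in `F′(θ)`, sign bit at the real place
(`true` = negative). [folklore] -/
structure GenData where
  /-- coordinates on `1, α, α²` -/
  g : ℤ × ℤ × ℤ
  /-- the norm -/
  n : ℤ
  /-- the rational prime below -/
  p : ℕ
  /-- residue degree -/
  f : ℕ
  /-- exponent in `F′(θ)` -/
  e : ℕ
  /-- sign bit at the real place (`true` = negative) -/
  sg : Bool

/-- One killed class, raw form: unit indices `T`, generator indices `U`, the prime `p ∈ killPrimes` of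
the residue-insolubility search and its fuel. [folklore] -/
structure KillRaw where
  /-- unit part of the class (indices into the unit family) -/
  T : List ℕ
  /-- generator part of the class (indices into `gens`) -/
  U : List ℕ
  /-- the kill prime -/
  p : ℕ
  /-- search fuel of `killCheck` -/
  fuel : ℕ

/-- The 2-descent certificate of one curve `y² = x³ + Ax² + Bx + C` over a cubic field with `m` listed
units: a prime `p0` modulo which `F` has no root, the root `θ` (coordinates `t`), the unit `u` of
`F′(θ) = u·∏ gⱼ^eⱼ` with its inverse, the generators, the square-residue moduli `Q`, the killed classes
(none for a `≤ 4`-class row, one for an `8`-class row, `≥ 9` for a `16`-class row). [folklore] -/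
structure CurveCert (m : ℕ) where
  /-- `a₂` -/
  A : ℤ
  /-- `a₄` -/
  B : ℤ
  /-- `a₆` -/
  C : ℤ
  /-- a prime modulo which `F` has no root -/
  p0 : ℕ
  /-- coordinates of the root `θ` of `F` -/
  t : ℤ × ℤ × ℤ
  /-- the unit cofactor of `F′(θ)` -/
  u : ℤ × ℤ × ℤ
  /-- its inverse -/
  uinv : ℤ × ℤ × ℤ
  /-- the prime generators of the support of `F′(θ)` -/
  gens : List GenData
  /-- square-residue moduli of the admissibility test -/
  Q : List ℕ
  /-- the killed classes -/
  kills : List KillRaw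

/-! ## Clause 1: the model is an elliptic curve -/

/-- `Δ` of the model `(0, A, 0, B, C)` as an integer polynomial. [folklore] -/
def deltaShort (A B C : ℤ) : ℤ :=
  -16 * A ^ 2 * (4 * A * C - B ^ 2) - 64 * B ^ 3 - 432 * C ^ 2 + 288 * A * B * C

/-- `Δ(0, A, 0, B, C) = deltaShort A B C`. [folklore] -/
theorem Δ_shortModel (A B C : ℤ) :
    ((⟨0, A, 0, B, C⟩ : WeierstrassCurve ℚ)).Δ = (deltaShort A B C : ℤ) := by
  simp only [WeierstrassCurve.Δ, WeierstrassCurve.b₂, WeierstrassCurve.b₄, WeierstrassCurve.b₆,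
    WeierstrassCurve.b₈, deltaShort]
  push_cast
  ring

/-- The model is elliptic when `deltaShort ≠ 0`. [folklore] -/
theorem isElliptic_of_deltaShort_ne {A B C : ℤ} (h : deltaShort A B C ≠ 0) :
    ((⟨0, A, 0, B, C⟩ : WeierstrassCurve ℚ)).IsElliptic :=
  ⟨by rw [Δ_shortModel]; exact (show ((deltaShort A B C : ℤ) : ℚ) ≠ 0 by exact_mod_cast h).isUnit⟩

/-! ## Clause 2: no root modulo `p` (irreducibility of `F`, residue certificates) -/

/-- `t³ + At² + Bt + C` has no root modulo `p`, checked on the representatives `0 … p−1`. [folklore] -/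
def noRootMod (p : ℕ) (A B C : ℤ) : Bool :=
  decide (0 < p) &&
    (List.range p).all fun t => ((t : ℤ) ^ 3 + A * (t : ℤ) ^ 2 + B * (t : ℤ) + C) % (p : ℤ) != 0

/-- Soundness of `noRootMod`. [folklore] -/
theorem no_root_of_noRootMod {p : ℕ} {A B C : ℤ} (h : noRootMod p A B C = true) :
    ∀ t : ZMod p, t ^ 3 + (A : ZMod p) * t ^ 2 + (B : ZMod p) * t + (C : ZMod p) ≠ 0 := by
  simp only [noRootMod, Bool.and_eq_true, decide_eq_true_eq, List.all_eq_true, List.mem_range] at h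
  obtain ⟨hp, hall⟩ := h
  haveI : NeZero p := ⟨hp.ne'⟩
  intro t ht
  have hne := bne_iff_ne.mp (hall t.val (ZMod.val_lt t))
  apply hne
  apply Int.emod_eq_zero_of_dvd
  rw [← ZMod.intCast_zmod_eq_zero_iff_dvd]
  push_cast
  rw [ZMod.natCast_zmod_val]
  exact ht

/-- `F = X³ + AX² + BX + C` is irreducible over `ℚ` when it has no root modulo some `p`. [folklore] -/
theorem irreducible_of_noRootMod {p : ℕ} {A B C : ℤ} (h : noRootMod p A B C = true) :
    Irreducible (MonicCubic.polyQ A B C) :=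
  irreducible_polyQ_of_no_root_mod p (no_root_of_noRootMod h)

/-- Residue certificate of a degree-`2`/`3` prime: `c₀ + c₁t + c₂t² ≠ 0` at every root `t` of the field
cubic modulo `p`, checked on representatives. [folklore] -/
def powCertMod (p : ℕ) (a b c : ℤ) (g : ℤ × ℤ × ℤ) : Bool :=
  decide (0 < p) &&
    (List.range p).all fun t =>
      (((t : ℤ) ^ 3 + a * (t : ℤ) ^ 2 + b * (t : ℤ) + c) % (p : ℤ) != 0) ||
        ((g.1 + g.2.1 * (t : ℤ) + g.2.2 * (t : ℤ) ^ 2) % (p : ℤ) != 0)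

/-- Soundness of `powCertMod` (the hypothesis `hcert` of `lin_prime_of_pow`). [folklore] -/
theorem cert_of_powCertMod {p : ℕ} {a b c : ℤ} {g : ℤ × ℤ × ℤ} (h : powCertMod p a b c g = true) :
    ∀ t : ZMod p, t ^ 3 + (a : ZMod p) * t ^ 2 + (b : ZMod p) * t + (c : ZMod p) = 0 →
      (g.1 : ZMod p) + (g.2.1 : ZMod p) * t + (g.2.2 : ZMod p) * t ^ 2 ≠ 0 := by
  simp only [powCertMod, Bool.and_eq_true, decide_eq_true_eq, List.all_eq_true, List.mem_range,
    Bool.or_eq_true] at h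
  obtain ⟨hp, hall⟩ := h
  haveI : NeZero p := ⟨hp.ne'⟩
  intro t ht hg
  rcases hall t.val (ZMod.val_lt t) with hne | hne
  · apply bne_iff_ne.mp hne
    apply Int.emod_eq_zero_of_dvd
    rw [← ZMod.intCast_zmod_eq_zero_iff_dvd]
    push_cast
    rw [ZMod.natCast_zmod_val]
    exact ht
  · apply bne_iff_ne.mp hne
    apply Int.emod_eq_zero_of_dvd
    rw [← ZMod.intCast_zmod_eq_zero_iff_dvd]
    push_cast
    rw [ZMod.natCast_zmod_val]
    exact hg

/-! ## Clause 3: the generators -/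

/-- The real-sign condition of `lin_pos` / `lin_neg` on the isolating interval `lo < ρ(α) < hi`, as a Bool.
[folklore] -/
def signCond (lo hi : ℚ) (g : ℤ × ℤ × ℤ) (sg : Bool) : Bool :=
  if sg then
    decide ((g.1 : ℚ) + max ((g.2.1 : ℚ) * lo) ((g.2.1 : ℚ) * hi) +
      max ((g.2.2 : ℚ) * lo ^ 2) ((g.2.2 : ℚ) * hi ^ 2) < 0)
  else
    decide (0 < (g.1 : ℚ) + min ((g.2.1 : ℚ) * lo) ((g.2.1 : ℚ) * hi) +
      min ((g.2.2 : ℚ) * lo ^ 2) ((g.2.2 : ℚ) * hi ^ 2))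

/-- The per-generator check: norm form value, `|n| = p^f` with the residue certificate for `f ≥ 2`, and the
sign condition. (Primality of the rational prime `p` is a separate `norm_num` side goal.) [folklore] -/
def GenData.check (a b c : ℤ) (lo hi : ℚ) (d : GenData) : Bool :=
  decide (MonicCubic.normForm a b c d.g.1 d.g.2.1 d.g.2.2 = d.n) &&
    ((decide (d.f = 1) && decide (d.n.natAbs = d.p)) ||
      ((decide (d.f = 2) || decide (d.f = 3)) && decide (d.n.natAbs = d.p ^ d.f) &&
        powCertMod d.p a b c d.g)) &&
    signCond lo hi d.g d.sg

section sound

variable {K : Type*} [Field K] [NumberField K] {a b c : ℤ} {α : K}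

/-- **Norm of a checked generator.** [folklore] -/
theorem GenData.norm_of_check (hirr : Irreducible (MonicCubic.polyQ a b c))
    (hα : aeval α (MonicCubic.poly a b c) = 0) (h3 : finrank ℚ K = 3) {lo hi : ℚ} {d : GenData}
    (h : d.check a b c lo hi = true) :
    Algebra.norm ℚ ((lin hα d.g.1 d.g.2.1 d.g.2.2 : 𝓞 K) : K) = ((d.n : ℤ) : ℚ) := by
  simp only [GenData.check, Bool.and_eq_true, decide_eq_true_eq] at h
  exact norm_lin_eq hirr hα h3 _ _ _ h.1.1

/-- **A checked generator is a prime element** (given the primality of the rational prime below it).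
[cite: Marcus2018, Ch. 3, Thm. 22] -/
theorem GenData.prime_of_check (hirr : Irreducible (MonicCubic.polyQ a b c))
    (hα : aeval α (MonicCubic.poly a b c) = 0) (h3 : finrank ℚ K = 3) {lo hi : ℚ} {d : GenData}
    (h : d.check a b c lo hi = true) (hp : d.p.Prime) :
    Prime (lin hα d.g.1 d.g.2.1 d.g.2.2 : 𝓞 K) := by
  simp only [GenData.check, Bool.and_eq_true, Bool.or_eq_true, decide_eq_true_eq] at h
  obtain ⟨⟨hn, hdeg⟩, -⟩ := h
  rcases hdeg with ⟨-, h1⟩ | ⟨⟨hf, hN⟩, hcert⟩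
  · exact lin_prime_of_prime hirr hα h3 _ _ _ hn (by rw [h1]; exact hp)
  · exact lin_prime_of_pow hirr hα h3 _ _ _ hn hp hf hN (cert_of_powCertMod hcert)

omit [NumberField K] in
/-- **Sign of a checked generator at the real place** (`Bool ↔` form of `admStd_sound`). [folklore] -/
theorem GenData.sign_iff_of_check (hα : aeval α (MonicCubic.poly a b c) = 0) (ρ : K →+* ℝ)
    {lo hi : ℚ} (h0 : 0 ≤ lo) (hlo : ((lo : ℚ) : ℝ) < ρ α) (hhi : ρ α < ((hi : ℚ) : ℝ)) {d : GenData}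
    [NumberField K] (h : d.check a b c lo hi = true) :
    (d.sg = true ↔ ρ ((lin hα d.g.1 d.g.2.1 d.g.2.2 : 𝓞 K) : K) < 0) := by
  simp only [GenData.check, Bool.and_eq_true] at h
  obtain ⟨-, hs⟩ := h
  unfold signCond at hs
  cases hsg : d.sg
  · rw [hsg] at hs
    simp only [Bool.false_eq_true, ↓reduceIte, decide_eq_true_eq] at hs
    exact sg_false_iff_of_pos (lin_pos hα ρ h0 hlo hhi _ _ _ hs)
  · rw [hsg] at hs
    simp only [↓reduceIte, decide_eq_true_eq] at hs
    exact sg_true_iff_of_neg (lin_neg hα ρ h0 hlo hhi _ _ _ hs)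

end sound

/-! ## The whole-row checker -/

/-- A raw kill as a `KillEntry` over the unit coordinates `cu` and generator coordinates `cg` (the class
representative's coordinates are computed here, so `killListCheck`'s product clause holds by evaluation).
[folklore] -/
def KillRaw.toEntry (a b c : ℤ) {m s : ℕ} (cu : Fin m → ℤ × ℤ × ℤ) (cg : Fin s → ℤ × ℤ × ℤ) (k : KillRaw) :
    KillEntry m s :=
  ⟨Finset.univ.filter fun i : Fin m => i.val ∈ k.T, Finset.univ.filter fun j : Fin s => j.val ∈ k.U,
    prodCoords a b c cu cg (Finset.univ.filter fun i : Fin m => i.val ∈ k.T)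
      (Finset.univ.filter fun j : Fin s => j.val ∈ k.U), k.p, k.fuel⟩

/-- Generator coordinates of the row as a `Fin`-family. [folklore] -/
def CurveCert.cg {m : ℕ} (cc : CurveCert m) : Fin cc.gens.length → ℤ × ℤ × ℤ := fun j => (cc.gens.get j).g

/-- The killed classes of the row as `KillEntry`s. [folklore] -/
def CurveCert.killEntries {m : ℕ} (a b c : ℤ) (ucoords : Fin m → ℤ × ℤ × ℤ) (cc : CurveCert m) :
    List (KillEntry m cc.gens.length) :=
  cc.kills.map (KillRaw.toEntry a b c ucoords cc.cg)

/-- The sieve of the row: residue-square + real-sign admissibility, minus the killed classes. [folklore] -/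
def CurveCert.adm {m : ℕ} (a b c : ℤ) (ucoords : Fin m → ℤ × ℤ × ℤ) (Nu : Fin m → ℤ) (su : Fin m → Bool)
    (cc : CurveCert m) : Finset (Fin m) → Finset (Fin cc.gens.length) → Bool :=
  admKills (admStdQ cc.Q Nu (fun j => (cc.gens.get j).n) su (fun j => (cc.gens.get j).sg))
    (cc.killEntries a b c ucoords)

/-- **The row checker.** Field inputs: the field cubic `(a, b, c)`, the isolating interval `(lo, hi)` of
`ρ(α)`, the unit family's coordinates / norms / sign bits. Clauses: elliptic; `F` has no root mod `p0`;
`F(θ) = 0`; `F′(θ) = u·∏ gⱼ^eⱼ` and `u·u⁻¹ = 1`; every generator checked; generator coordinates pairwise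
distinct; `disc F < 0` (complex cubic); residue moduli positive; the kill list certificate
(`killListCheck`: each killed class is a non-zero element whose covering has no primitive point modulo a
power of its prime); no killed class is the trivial class; fewer than `2³` classes survive.
[cite: Cassels1991LecturesEllipticCurves, §15] [cite: CremonaAlgorithms1997, §3.6] -/
def CurveCert.check {m : ℕ} (a b c : ℤ) (lo hi : ℚ) (ucoords : Fin m → ℤ × ℤ × ℤ) (Nu : Fin m → ℤ)
    (su : Fin m → Bool) (cc : CurveCert m) : Bool :=
  decide (deltaShort cc.A cc.B cc.C ≠ 0) &&
  noRootMod cc.p0 cc.A cc.B cc.C &&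
  decide (cubicAtCoords a b c cc.A cc.B cc.C cc.t = (0, 0, 0)) &&
  decide (derivAtCoords a b c cc.A cc.B cc.t =
    MonicCubic.mulCoords a b c cc.u (prodPowCoords a b c (cc.gens.map fun d => (d.g, d.e)))) &&
  decide (MonicCubic.mulCoords a b c cc.u cc.uinv = (1, 0, 0)) &&
  cc.gens.all (GenData.check a b c lo hi) &&
  decide ((cc.gens.map GenData.g).Nodup) &&
  decide (MonicCubic.disc cc.A cc.B cc.C < 0) &&
  (cc.Q.all fun q => decide (0 < q)) &&
  killListCheck a b c cc.t.2.1 cc.t.2.2 ucoords cc.cg (cc.killEntries a b c ucoords) &&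
  ((cc.killEntries a b c ucoords).all fun e => !(decide (e.T = ∅) && decide (e.U = ∅))) &&
  decide (((Finset.univ ×ˢ Finset.univ).filter
      (fun TU : Finset (Fin m) × Finset (Fin cc.gens.length) =>
        cc.adm a b c ucoords Nu su TU.1 TU.2 = true)).card < 2 ^ 3)

/-! ## Kernel sanity check on census data: the row of `10120g1` over `ℚ(α)`, `α³ = α + 1` (field `−23`:
units `(−1, 1 − α²)`, norms `(−1, −1)`, both negative; interval `331/250 < α < 53/40`) -/

/-- The v1.x certificate of `10120g1` (`Rank2Observatory10120g1TwoDescRankTwo`) as a row; the checker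
accepts it (kernel evaluation). [cite: CremonaAlgorithms1997, §3.5 (label `10120g1`)] -/
example : CurveCert.check 0 (-1) (-1) (331 / 250) (53 / 40) ![((-1 : ℤ), 0, 0), (1, 0, -1)] ![-1, -1] ![true, true]
    (⟨0, -2743, 56767, 2, (12, -31, -18), (0, -1, -1), (1, -1, 0),
      [⟨(-1, 1, -2), -25, 5, 2, 1, true⟩, ⟨(5, 4, -3), 121, 11, 2, 2, false⟩, ⟨(1, 3, -1), 23, 23, 1, 3, false⟩],
      [4], [⟨[1], [0], 2, 2⟩]⟩ : CurveCert 2) = true := by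
  decide +kernel

end Summit.BirchSwinnertonDyer.BirchSwinnertonDyer.Rank2Observatory.TwoDescCubic
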